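import Literature.AlgebraicGeometry.Motives.CyclesEquivalencesFlatPullbackProofs
import HarnessLib

/-!
# Restricting a cycle to a closed subscheme containing its support

For a closed immersion `i : Z ↪ X` and a cycle `c` on `X` (Mathlib `AlgebraicCycle X ℤ`, a
function on the points of `X` with locally finite support) we define the cycle
`cycleRestrictClosed i c` on `Z` with coefficients `z ↦ c (i z)` — the cycle `β` on `Z` with
`i_* β = c` when `c` is supported on `i(Z)` (Fulton, *Intersection Theory*, §1.8/Prop. 1.8 and the
convention of §1.4: cycles on a closed subscheme `Y ⊆ X` are identified with the cycles on `X`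
supported on `Y`, "we will write `α` also for its image `i_* α`"; here the inverse direction).
Proved: `i_* (cycleRestrictClosed i c) = c` iff-style statements (`map_cycleRestrictClosed` when
`support c ⊆ range i`, and `cycleRestrictClosed_map : cycleRestrictClosed i (i_* β) = β`),
additivity (`cycleRestrictClosedHom`), and preservation of the dimension grading
(`cycleRestrictClosed_mem_cyclesOfDim`, closed immersions preserve `Order.height`,
`height_apply_of_isClosedImmersion` of `Motives/CyclesEquivalencesFlatPullbackProofs`).

This is the bookkeeping needed to let an intersection class `D · [V]`, a cycle on `X` supported on
the support `|D|` of a Cartier divisor (Fulton, Def. 2.3, `A_{k-1}(|D| ∩ V)`), live on the closed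
subscheme `|D|` itself — as in the restriction map `CH_{r+1}(Y') → CH_r(Y)` to a Cartier divisor
`Y ⊂ Y'` (Hirschowitz–Iyer, Contemp. Math. 522 (2010), §2; `Motives/HirschowitzIyerQuadricCubic`).
Rational equivalence is NOT transported (a cycle on `X` supported on `Z` and rationally
equivalent to zero on `X` need not be so on `Z`; that is the content of the localisation sequence,
`Motives/ChowLocalization`).

## References

* W. Fulton, *Intersection Theory*, 2nd ed., Springer (1998), §1.4 (conventions on `i_*`),
  Prop. 1.8 (exactness of `A_k Y → A_k X → A_k U → 0`). [Fulton1998]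
-/

noncomputable section

universe u

open CategoryTheory AlgebraicGeometry Order Topology

namespace Literature.AlgebraicGeometry.Motives

variable {Z X : Scheme.{u}} (i : Z ⟶ X) [IsClosedImmersion i]

/-- **Restriction of a cycle to a closed subscheme**: for a closed immersion `i : Z ↪ X` and a
cycle `c` on `X`, the cycle on `Z` with coefficient `c (i z)` at `z`. Its support is locally
finite because `i` is a topological embedding. When `c` is supported on `i(Z)` this is the unique
cycle `β` on `Z` with `i_* β = c` (`map_cycleRestrictClosed`); in general it forgets the
coefficients off `i(Z)`. (Fulton §1.4: cycles on a closed subscheme versus cycles on `X` supported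
on it.) [folklore] -/
def cycleRestrictClosed (c : AlgebraicCycle X ℤ) : AlgebraicCycle Z ℤ where
  toFun z := c (i z)
  supportWithinDomain' := Set.subset_univ _
  supportLocallyFiniteWithinDomain' z _ := by
    obtain ⟨t, ht, hfin⟩ := c.locallyFiniteSupport (i z)
    refine ⟨i ⁻¹' t, i.continuous.continuousAt.preimage_mem_nhds ht, ?_⟩
    have hinj : Set.InjOn (i : Z → X) ((i : Z → X) ⁻¹' (t ∩ Function.support c)) :=
      i.isClosedEmbedding.injective.injOn
    refine (hfin.preimage hinj).subset ?_
    rintro w ⟨hw, hw'⟩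
    exact ⟨hw, hw'⟩

/-- The coefficient of the restricted cycle at `z` is the coefficient of `c` at `i z` (`rfl`).
[folklore] -/
@[simp]
theorem cycleRestrictClosed_apply (c : AlgebraicCycle X ℤ) (z : Z) :
    cycleRestrictClosed i c z = c (i z) :=
  rfl

/-- Restriction to a closed subscheme is additive. [folklore] -/
def cycleRestrictClosedHom : AlgebraicCycle X ℤ →+ AlgebraicCycle Z ℤ where
  toFun := cycleRestrictClosed i
  map_zero' := by ext z; rfl
  map_add' c c' := by ext z; rfl

/-- `cycleRestrictClosedHom i` is `cycleRestrictClosed i` (`rfl`). [folklore] -/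
@[simp]
theorem cycleRestrictClosedHom_apply (c : AlgebraicCycle X ℤ) :
    cycleRestrictClosedHom i c = cycleRestrictClosed i c :=
  rfl

/-- **`i_* ∘ restrict = id` on cycles supported on `i(Z)`**: if every point with nonzero
coefficient lies in the image of the closed immersion, pushing the restricted cycle forward
(Mathlib `AlgebraicCycle.map`, extension by zero along a closed immersion,
`map_apply_of_isClosedImmersion`) gives back `c` (Fulton §1.4, Prop. 1.8: a cycle on `X`
supported on the closed subscheme is `i_* β`). [cite: Fulton1998, Proposition 1.8] -/
theorem map_cycleRestrictClosed (c : AlgebraicCycle X ℤ) (hc : Function.support c ⊆ Set.range i) :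
    AlgebraicCycle.map i height height (cycleRestrictClosed i c) = c := by
  ext x
  by_cases hx : x ∈ Set.range i
  · obtain ⟨z, rfl⟩ := hx
    rw [map_apply_of_isClosedImmersion]
    rfl
  · rw [map_apply_of_notMem_range i _ x hx]
    exact (Function.notMem_support.mp fun h ↦ hx (hc h)).symm

/-- **`restrict ∘ i_* = id`**: restricting the push-forward of a cycle `β` on `Z` gives back `β`.
[folklore] -/
theorem cycleRestrictClosed_map (β : AlgebraicCycle Z ℤ) :
    cycleRestrictClosed i (AlgebraicCycle.map i height height β) = β := by
  ext z
  exact map_apply_of_isClosedImmersion i β z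

/-- A cycle supported on `i(Z)` whose restriction vanishes is zero. [folklore] -/
theorem eq_zero_of_cycleRestrictClosed_eq_zero {c : AlgebraicCycle X ℤ}
    (hc : Function.support c ⊆ Set.range i) (h : cycleRestrictClosed i c = 0) : c = 0 := by
  rw [← map_cycleRestrictClosed i c hc, h, algebraicCycleMap_zero]

/-- Restriction to a closed subscheme preserves the dimension grading: closed immersions preserve
`Order.height` (the dimension of point closures). [folklore] -/
theorem cycleRestrictClosed_mem_cyclesOfDim {d : ℕ} {c : AlgebraicCycle X ℤ}
    (hc : c ∈ cyclesOfDim X d) : cycleRestrictClosed i c ∈ cyclesOfDim Z d := by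
  intro z hz
  rw [← height_apply_of_isClosedImmersion i z]
  exact hc _ hz

/-- The support of the restricted cycle is the preimage of the support. [folklore] -/
theorem support_cycleRestrictClosed (c : AlgebraicCycle X ℤ) :
    Function.support (cycleRestrictClosed i c) = (i : Z → X) ⁻¹' Function.support c :=
  rfl

end Literature.AlgebraicGeometry.Motives

end
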